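/- Copyright: the b2b-balaban cell (near-miss cell 7), T⁴-continuum fan-out; row NE7b CRUX team (2), seat
t4-ne7b-formalise-leaf-05 (gen 32) — the row OWNER's SPEC IR-46-2 «THE (α) ASSEMBLY» v0 l.15 «… leaf-05 toy» (owner gen 47
close, `CLAIMS.log` l.32260; custodian leaf-03 gen 26's FILE 1 p279430 ∕ FILE 2 p281050; my booking l.32351).
Released under the licence of the surrounding project. -/
import Summits.QuantumFields.BalabanUV.T4Continuum.Support.HistoryRealiseCellsRunAssemblyWTVSData
import Summits.QuantumFields.BalabanUV.T4Continuum.Support.HistoryRealiseCellsRunSupplyKeysWTVSSanity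
import Summits.QuantumFields.BalabanUV.T4Continuum.Support.HistoryGenealogyJunctionVDistinct

/-!
# Sanity for the (α) assembly, part 1: A TOY READING WITH (c1)'s EQUATIONS BY CONSTRUCTION, ONE SET OF LETTERS AT GIVEN
RUNNING COUPLINGS, AND THE TOY (1.72)-EXPANSION OF A GIVEN GENERATING FUNCTION (companion of
`HistoryRealiseCellsRunAssemblyWTVSData` ∕ `HistoryRealiseCellsRunAssemblyWTVS`; SPEC IR-46-2 v0 «leaf-05 toy», lineage
`t4-ne7b-formalise-leaf-05` gen 32; part 2 = `…SanityEnd`: run B, the S-sockets, the record `HistReadData` on this toy and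
FILE 2's END read BY NAME; part 3 = `…SanityToyData`: the record with NO hypothesis on the cell's toy datum)

Summits-side support leaf of the T⁴-continuum cell (rung (B)+1 on a FINITE torus only; NOT infinite volume, NOT the
mass gap, NOT Clay; NOT a proof of NE7b — the cell's OWN estimate, NOT PRINTED, NOT PROVED).  [folklore] decided toy
arithmetic over M1's sanity skeleton (`toyI` ∕ `Isk` ∕ `μ₀`, leaf-04's `B16HistoryInputFamilySanity`) and the toy
constants ∕ shares of the gen-31 sanity pair (`C₂`, `φB₁`, `φR₁`; `O₁` of `HistoryConstants.Sanity`), REUSED BY NAME; one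
computable `DecidableEq` instance for the toy index type (FILE 1 ∕ FILE 2 BIND it, (c7)); NO datum is imported here (the
letters take the running couplings `g : ℕ → ℕ → ℝ` and the generating function `Z : ℕ → ℝ → ℝ` as parameters); nothing
printed asserted, no `def … : Prop` fact, no cite-tagged hypothesis, zero `sorry`.

§1 THE TOY READING `ℛ₃ L` WITH (c1)'s EQUATIONS BY CONSTRUCTION: NO large-field region (`N ≡ ∅`, `F ≡ ∅`), blocking
parameter `L` (instantiated at `F.L` in part 2), constant sizes `R ≡ L` — a power of `L`, so the flow display (2.5)
`isRj` stays SATISFIABLE (it pins the couplings to `1 < (log g⁻²)^rr ≤ L`; `R ≡ 2` would contradict it under `4 ≤ F.L`,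
and `rr = 0` would force `R ≡ 1 < 2 ≤ Rm`) — exponents `s := runProfile L R` (≡ `Nat.log L L`: `hs`∕`hL` hold by `rfl`,
and the flow's K-facts are PROVED — `runProfile_succ_le_toy`, `dropCtl_runProfile_toy`: a constant profile is
non-increasing with drop control), memory `Rm ≡ 2` (`rm2_run₃`; `rm_le_run₃`∕`rmS_run₃` from `2 ≤ L`); the pass-V input
conditions `newOK_run₃`∕`newDisjoint_run₃`∕`inBoxOK_run₃`∕`regionsInBox_run₃` (vacuous); (2.9) `flow29_const` PROVED on
constant sizes at `β₀ = 0` (any couplings, any `β′`); NO live name, NO bad term, NO bad key class (`liveCV_eq_empty₃`,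
`memOf_toy₃`, `kmemOf_toy₃`, `badTerms_toy₃`, `badGMems_toy₃` and their pointwise forms) — so `huV`, (ρ)∕(ρ′), the run-B
«TRUNC» readings and the S1c-opt clauses `hDJ`∕`hBB` of FILE 1 are VACUOUS on the toy (located, by design).
§2 ONE SET OF LETTERS AT GIVEN RUNNING COUPLINGS `g K` AND A GIVEN GENERATING FUNCTION `Z K t`: the owner's toy sharp
letters WITH the fibre share `sB₃ L g`∕`sR₃ L g` (`sBF`∕`sRF` at `C₂`, `L`, `R ≡ L`, `O₁`), the factor data `Φ₃ L g Z`
EXPONENTIATING them (`Λ ≡ 1`, unit envelopes, `BV ≡ 0`, completed-action envelope `BA K t := log (Z K t ∕ 6)`) ⇒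
`factorRead_toy` (`hF`, with equality), `roundingRoomF_toy₃` (`hRR` AND `hRR′`), the calibrated volume displays at
`Lu ≡ 1`, `jl ≡ 20` (`hLu_toy₃`, `huΦ_toy₃`, `huE₂_toy₃`, `huE₃_toy₃`), `BA_le_of_le` (`hBA` from a K-uniform bound
`Z ≤ Zi`); and **THE TOY (1.72)-EXPANSION `toyR z`** of a number `z > 0` over M1's skeleton — identity operations,
`χ ≡ 1`, `V ≡ 0`, completed action `log (z∕6)`: `eterm_toyR` (every elementary term weighs `z∕6`), `card_LIdx_toyI` (`2`
and `4` choices, decided), **`sum_term_toyR : Σ_a (toyR z).term a V = z`** («(1.72) holds» with density `z`),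
**`weight_toyR : weight μ₀ (fun K t => toyR (Z K t)) t ⟨K, a, ι⟩ = Z K t ∕ 6`**, `weight_toyR_nonneg`, and
`histRead_toy₃ : HistRead (ℛ₃ L) (Φ₃ L g Z) (fun K t => toyR (Z K t)) 1 0` (THE identification: empty forest, envelopes
attained) — ALL AT ONE SET OF LETTERS.  Part 2 instantiates `g := (D.C ⟨K, F.m, g₀ K⟩).flow.g`, `Z := ZD D g₀ os` (the
datum's dressed generating function), so that FILE 1's H2 displays hold BY CONSTRUCTION for every datum.

R-OWNER-48-1 «THE GUARDED CUT» (`CLAIMS.log` l.32451).  FILE 1's record is uninhabitable AS TYPED for readings WITH a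
live join (the unguarded display `hDJ`); this toy names NO live component, so `hDJ`∕`hBB` are vacuous here — consistent
with the ruling, and no claim beyond it; §1–§2 serve the guarded twin `HistReadDataL` (fields `hDJ`∕`hBB` deleted,
`hbox ↦ hreg`) UNCHANGED (`regionsInBox_run₃` is its `hreg` on the toy).

HONEST.  Proves nothing of Bałaban's; every R∕S field of `HistReadData` stays a HYPOTHESIS of the assembly (here the
reading-level ones get TOY inhabitants — c2 — never print's values); BY-NAME EFFECT ON THE WALL: NONE; headline p224237 ∕
END v3.1′ ∕ W∕V∕VS headlines UNCHANGED; NE7b NOT proved; spine 0∕9.  HONEST DEPENDENCY (cell): continuum YM on T⁴ ⇐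
BetaPertH ∧ nine spine estimates (0/9 proved); BetaPertH ⇐ (D1) ∧ (D4) ∧ CAP+tail; G-an2-4 gates asym, D1 and NE2/3/4.
Unchanged here.
-/



open Finset MeasureTheory
open Literature.MathematicalPhysics.QuantumFieldTheory.Balaban1983to89
open Literature.MathematicalPhysics.QuantumFieldTheory.Balaban1983to89.B16SProfile (DropCtl)
open T4PersistenceDictionary T4PersistentHistoryCount T4BankedInduction T4PrintedShapeBanking
open T4WeightBudget T4GlobalDenominator T4LiveClassFibration T4LiveStructureGas T4LiveGasToTerms T4RecordPriceSeam
open T4PartnerMultiplicity T4IndicatorShell T4MatchingAssembly T4MatchingClosure T4MatchingClosureSocket T4Continuum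
open T4StabilitySocket T4BranchingRecordsGas T4TaggedShapeBanking T4CanonicalMenus T4RenewalChains
open Summit.QuantumFields.BalabanUV.T4Continuum.HistoryFlow Summit.QuantumFields.BalabanUV.T4Continuum.HistoryGen
open Summit.QuantumFields.BalabanUV.T4Continuum.HistoryAdmissible
open Summit.QuantumFields.BalabanUV.T4Continuum.HistoryGenealogyExtraction
open Summit.QuantumFields.BalabanUV.T4Continuum.HistoryGenealogyRealise
open Summit.QuantumFields.BalabanUV.T4Continuum.HistoryGenealogyInstantiate
open Summit.QuantumFields.BalabanUV.T4Continuum.HistoryGenealogyPedigree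
open Summit.QuantumFields.BalabanUV.T4Continuum.HistoryAssemblyPedigree Summit.QuantumFields.BalabanUV.T4Continuum.HistoryAssemblyTerms
open Summit.QuantumFields.BalabanUV.T4Continuum.HistoryAssemblyMult Summit.QuantumFields.BalabanUV.T4Continuum.HistoryAssemblyMultKey
open Summit.QuantumFields.BalabanUV.T4Continuum.HistoryAssemblyRealiseRun Summit.QuantumFields.BalabanUV.T4Continuum.HistorySocketTH
open Summit.QuantumFields.BalabanUV.T4Continuum.HistoryRealiseDistinct
open Summit.QuantumFields.BalabanUV.T4Continuum.HistoryRealiseCellsRunApexT3bWTVS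
open Summit.QuantumFields.BalabanUV.T4Continuum.B16HistoryIndexedRepr
open Summit.QuantumFields.BalabanUV.T4Continuum.B16HistoryIndexedTrunc
open Summit.QuantumFields.BalabanUV.T4Continuum.HistoryBankingLE Summit.QuantumFields.BalabanUV.T4Continuum.HistoryBankingVolumePlug
open Summit.QuantumFields.BalabanUV.T4Continuum.HistoryConstants Summit.QuantumFields.BalabanUV.T4Continuum.HistoryBankingDiscountCharge
open Summit.QuantumFields.BalabanUV.T4Continuum.HistoryBankingCreditRead Summit.QuantumFields.BalabanUV.T4Continuum.HistoryBankingFibreRoom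
open Summit.QuantumFields.BalabanUV.T4Continuum.HistoryPriceNodeSum Summit.QuantumFields.BalabanUV.T4Continuum.HistoryPriceKeys
open Summit.QuantumFields.BalabanUV.T4Continuum.HistoryRealiseCellsRunSupplyWTVS
open Summit.QuantumFields.BalabanUV.T4Continuum.HistoryRealiseCellsRunSupplyKeysWTVS
open Summit.QuantumFields.BalabanUV.T4Continuum.HistoryRealiseCellsRunSupplyWTVSSanity
open Summit.QuantumFields.BalabanUV.T4Continuum.HistoryRealiseCellsRunSupplyKeysWTVSSanity
open Summit.QuantumFields.BalabanUV.T4Continuum.HistoryRealiseCellsRunAssemblyWTVSData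

namespace Summit.QuantumFields.BalabanUV.T4Continuum.HistoryRealiseCellsRunAssemblyWTVSSanity

noncomputable section

open B16HistoryIndexedRepr.Sanity B16HistoryIndexedRepr.SanityInput HistoryConstants.Sanity HistoryBankingCreditRead.Sanity
open HistoryBankingFibreRoom.Sanity

-- the structural `DecidableEq` instance of the concrete tag type exceeds the default synthesis size (as in the siblings)
set_option synthInstance.maxSize 1024

/-- the K-uniform index type of the toy skeleton is `Σ K : ℕ, Σ _ : Bool, Fin 2 × Unit × Fin 2` — decidable equality
(FILE 1 ∕ FILE 2 BIND this instance, (c7); the toy supplies it). [folklore] -/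
instance instDecidableEqIdxIsk : DecidableEq (HIndex.Idx Isk) :=
  inferInstanceAs (DecidableEq (Σ _ : ℕ, Σ _ : Bool, Fin 2 × Unit × Fin 2))

/-! ## §1 The toy reading with (c1)'s equations by construction, and its reading-level displays -/

/-- **THE TOY READING AT BLOCKING PARAMETER `L`**: no new region, no new field; constant sizes `R ≡ L` (a power of `L`),
exponents `s := runProfile L R` (the run's own profile — (c1) BY CONSTRUCTION), memory `Rm ≡ 2` (dimension `1`,
skeleton `Isk`). [folklore] -/
def ℛ₃ (L : ℕ) : HistReading Isk 1 where
  L := L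
  s := runProfile L (fun _ _ => L)
  R _ _ := L
  Rm _ _ _ := 2
  N _ _ _ _ := ∅
  cls _ _ _ _ := 0
  F _ _ _ _ := ∅

variable (L : ℕ)

/-- the runs read off `ℛ₃ L` name no region, hence have no dissolved component at any level [folklore] -/
theorem comp_run_eq_empty₃ (K : ℕ) (τ : HIndex.Idx Isk) (j : ℕ) : ((ℛ₃ L).inputOf.run K τ).histV.comp j = ∅ :=
  ((ℛ₃ L).inputOf.run K τ).comp_histV_eq_empty_of_N (fun _ => rfl) j

/-- the real bookkeeping of the run read off a history choice has no component either [folklore] -/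
theorem compM_runOf_eq_empty₃ (K : ℕ) (a : (Isk K).Adm) (ι : (Isk K).HZ × (Isk K).HL × (Isk K).HC) (j : ℕ) :
    ((ℛ₃ L).runOf K a ι).histM.comp j = ∅ :=
  ((ℛ₃ L).runOf K a ι).comp_histM_eq_empty_of_N (fun _ => rfl) j

/-- NO LIVE NAME at any cutoff [folklore] -/
theorem liveCV_eq_empty₃ (K : ℕ) (τ : HIndex.Idx Isk) : (ℛ₃ L).inputOf.liveCV K τ = ∅ := by
  show (((ℛ₃ L).inputOf.run K τ).histV.comp K).image (Prod.mk K) = ∅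
  rw [comp_run_eq_empty₃, Finset.image_empty]

/-- the displayed input condition `NewOK` (vacuous) [folklore] -/
theorem newOK_run₃ (K : ℕ) (τ : HIndex.Idx Isk) : ((ℛ₃ L).inputOf.run K τ).NewOK :=
  ⟨fun _ _ hn => by simp [HistReading.inputOf, ℛ₃] at hn⟩

/-- disjoint new regions (vacuous) [folklore] -/
theorem newDisjoint_run₃ (K : ℕ) (τ : HIndex.Idx Isk) : ((ℛ₃ L).inputOf.run K τ).NewDisjoint :=
  fun _ _ hn => by simp [HistReading.inputOf, ℛ₃] at hn

/-- the box condition (vacuous) [folklore] -/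
theorem inBoxOK_run₃ (n K : ℕ) (τ : HIndex.Idx Isk) : ((ℛ₃ L).inputOf.run K τ).InBoxOK n K :=
  fun _ _ _ hn => by simp [HistReading.inputOf, ℛ₃] at hn

/-- the L-chain's input display `RegionsInBox` (R-OWNER-48-1 «THE GUARDED CUT», the `hreg` field of `HistReadDataL`) —
vacuous on the toy as well (no new region) [folklore] -/
theorem regionsInBox_run₃ (n K : ℕ) (τ : HIndex.Idx Isk) : ((ℛ₃ L).inputOf.run K τ).RegionsInBox n K :=
  fun _ _ _ hn => by simp [HistReading.inputOf, ℛ₃] at hn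

variable {L} in
/-- memory domination `Rm ≤ R` (`2 ≤ L`) [folklore] -/
theorem rm_le_run₃ (hL : 2 ≤ L) (K : ℕ) (τ : HIndex.Idx Isk) :
    ∀ t k, ((ℛ₃ L).inputOf.run K τ).Rm t k ≤ ((ℛ₃ L).inputOf.run K τ).R t := fun _ _ => hL

variable {L} in
/-- its one-step form [folklore] -/
theorem rmS_run₃ (hL : 2 ≤ L) (K : ℕ) (τ : HIndex.Idx Isk) :
    ∀ t k, ((ℛ₃ L).inputOf.run K τ).Rm t (k + 1) ≤ ((ℛ₃ L).inputOf.run K τ).R (t + 1) := fun _ _ => hL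

/-- non-degenerate memory `2 ≤ Rm t 1` [folklore] -/
theorem rm2_run₃ (K : ℕ) (τ : HIndex.Idx Isk) : ∀ t, 2 ≤ ((ℛ₃ L).inputOf.run K τ).Rm t 1 := fun _ => le_rfl

/-- **THE FLOW's K-FACT `hprof` IS PROVED ON THE TOY**: the run's own profile of constant sizes is constant. [folklore] -/
theorem runProfile_succ_le_toy (K t : ℕ) : runProfile L (ℛ₃ L).R K (t + 1) ≤ runProfile L (ℛ₃ L).R K t :=
  le_of_eq rfl

/-- **THE FLOW's K-FACT `hdrop` IS PROVED ON THE TOY**: a constant profile has drop control at every horizon. [folklore] -/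
theorem dropCtl_runProfile_toy (K m : ℕ) : DropCtl (runProfile L (ℛ₃ L).R K) m := fun i k _ _ => by
  show 2 * Nat.log L L ≤ 2 * Nat.log L L + max (k - i) 2
  exact Nat.le_add_right _ _

/-- **(2.9) IS PROVED ON CONSTANT SIZES at `β₀ = 0`** (any couplings, any `β′`, `1 ≤ L`). [folklore] -/
theorem flow29_const (hL : 1 ≤ L) (g : ℕ → ℝ) (β' : ℝ) (K : ℕ) :
    B14FlowStep.FlowIneq29 ((ℛ₃ L).R K) g L β' 0 K := by
  intro m n _ _
  have hL' : (1 : ℝ) ≤ L := by exact_mod_cast hL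
  have hL0 : (0 : ℝ) ≤ L := zero_le_one.trans hL'
  refine ⟨?_, ?_⟩
  · show (L : ℝ) ≤ L * L
    exact le_mul_of_one_le_left hL0 hL'
  · show (L : ℝ) ≤ L * (1 + g n ^ 2 * β' * ((n : ℝ) - m)) ^ (0 : ℝ) * L
    rw [Real.rpow_zero, mul_one]
    exact le_mul_of_one_le_left hL0 hL'

/-- the member family of every term is EMPTY (no live name) … [folklore] -/
theorem memOf_toy₃ {γ : Type*} [DecidableEq γ] (cellOf : ℕ → HIndex.Idx Isk → ℕ × Lab 1 → γ) (K : ℕ)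
    (τ : HIndex.Idx Isk) : memOf (ℛ₃ L).inputOf.pedV (ℛ₃ L).inputOf.liveCV cellOf K τ = ∅ := by
  unfold memOf
  rw [liveCV_eq_empty₃, Finset.image_empty]

/-- … so is the key family … [folklore] -/
theorem kmemOf_toy₃ {γ δ : Type*} [DecidableEq γ] [DecidableEq δ] (cellOf : ℕ → HIndex.Idx Isk → ℕ × Lab 1 → γ)
    (phys : ℕ → HIndex.Idx Isk → ℕ × Lab 1 → δ) (K : ℕ) (τ : HIndex.Idx Isk) :
    kmemOf (ℛ₃ L).inputOf.pedV (ℛ₃ L).inputOf.liveCV cellOf phys K τ = ∅ := by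
  unfold kmemOf
  rw [liveCV_eq_empty₃, Finset.image_empty]

/-- … NO term is bad … [folklore] -/
theorem badTerms_toy₃ {γ : Type*} [DecidableEq γ] (cellOf : ℕ → HIndex.Idx Isk → ℕ × Lab 1 → γ) (jstar : ℕ → ℕ)
    (K : ℕ) : badTerms (memOf (ℛ₃ L).inputOf.pedV (ℛ₃ L).inputOf.liveCV cellOf) jstar (HIndex.termSet Isk) K = ∅ :=
  Finset.filter_eq_empty_iff.2 fun τ _ => by rw [memOf_toy₃]; simp

/-- … and there is NO bad key class: the key-indexed fields (ρ)∕(ρ′)∕«TRUNC» are vacuous on the toy, by design. [folklore] -/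
theorem badGMems_toy₃ {γ δ : Type*} [DecidableEq γ] [DecidableEq δ] (cellOf : ℕ → HIndex.Idx Isk → ℕ × Lab 1 → γ)
    (phys : ℕ → HIndex.Idx Isk → ℕ × Lab 1 → δ) (jstar : ℕ → ℕ) (K : ℕ) :
    badGMems (memOf (ℛ₃ L).inputOf.pedV (ℛ₃ L).inputOf.liveCV cellOf) jstar (HIndex.termSet Isk)
      (kmemOf (ℛ₃ L).inputOf.pedV (ℛ₃ L).inputOf.liveCV cellOf phys) K = ∅ := by
  rw [badGMems, badTerms_toy₃, Finset.image_empty]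

/-- no live name (pointwise form, for the vacuous S1c-opt clauses) [folklore] -/
theorem not_mem_liveCV₃ (K : ℕ) (τ : HIndex.Idx Isk) (c : ℕ × Lab 1) : c ∉ (ℛ₃ L).inputOf.liveCV K τ := by
  rw [liveCV_eq_empty₃]; exact Finset.notMem_empty c

/-- no bad term (pointwise form, for the vacuous `huV`) [folklore] -/
theorem not_mem_badTerms₃ {γ : Type*} [DecidableEq γ] (cellOf : ℕ → HIndex.Idx Isk → ℕ × Lab 1 → γ) (jstar : ℕ → ℕ)
    (K : ℕ) (τ : HIndex.Idx Isk) :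
    τ ∉ badTerms (memOf (ℛ₃ L).inputOf.pedV (ℛ₃ L).inputOf.liveCV cellOf) jstar (HIndex.termSet Isk) K := by
  rw [badTerms_toy₃]; exact Finset.notMem_empty τ

/-- no bad key class (pointwise form, for the vacuous (ρ)∕(ρ′)∕«TRUNC» readings) [folklore] -/
theorem not_mem_badGMems₃ {γ δ : Type*} [DecidableEq γ] [DecidableEq δ] (cellOf : ℕ → HIndex.Idx Isk → ℕ × Lab 1 → γ)
    (phys : ℕ → HIndex.Idx Isk → ℕ × Lab 1 → δ) (jstar : ℕ → ℕ) (K : ℕ)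
    (k : Finset (γ × Gen PEv × δ)) :
    k ∉ badGMems (memOf (ℛ₃ L).inputOf.pedV (ℛ₃ L).inputOf.liveCV cellOf) jstar (HIndex.termSet Isk)
      (kmemOf (ℛ₃ L).inputOf.pedV (ℛ₃ L).inputOf.liveCV cellOf phys) K := by
  rw [badGMems_toy₃]; exact Finset.notMem_empty k

/-! ## §2 One set of toy letters at given running couplings, and the toy (1.72)-expansion of a given generating function -/

section Letters

variable (L : ℕ) (g : ℕ → ℕ → ℝ) (Z : ℕ → ℝ → ℝ)

/-- the toy sharp birth letters WITH the share, at the running couplings `g K` of run `K` [folklore] -/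
def sB₃ (K : ℕ) : ℕ → ℕ → ℝ := sBF C₂ L (fun _ => L) K O₁ (g K) φB₁

/-- the toy sharp renewal letters WITH the share, at the same couplings [folklore] -/
def sR₃ (K : ℕ) : ℕ → ℝ := sRF C₂ L (fun _ => L) O₁ (g K) φR₁

/-- **TOY FACTOR DATA WITH THE SHARP LETTERS EXPONENTIATED AT THE RUNNING COUPLINGS**: `fB := e^{−sB₃}`, `fR := e^{−sR₃}`,
unit per-cube cost and envelopes, zero last-exponent envelope, and the completed-action envelope `BA K t := log (Z K t ∕ 6)`
of the toy expansion `toyR (Z K t)` below. [folklore] -/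
def Φ₃ : HistFactors Isk 1 where
  fB K j d _ := Real.exp (-sB₃ L g K j d)
  fR K h := Real.exp (-sR₃ L g K h)
  Λ _ _ := 1
  one_le_Λ _ _ := le_rfl
  wZ _ _ _ _ := 1
  wY _ _ _ _ := 1
  wC _ _ _ _ := 1
  BA K t := Real.log (Z K t / 6)
  BV _ _ _ _ _ _ := 0

/-- **THE FACTOR READING HOLDS** at `(sB₃ K, sR₃ K)` — with equality. [folklore] -/
theorem factorRead_toy (K : ℕ) : FactorRead ((Φ₃ L g Z).fB K) ((Φ₃ L g Z).fR K) (sB₃ L g K) (sR₃ L g K) :=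
  factorRead_exp _ _

/-- **THE ROUNDING JUNCTION WITH THE FIBRE SHARE HOLDS** at the SAME letters and couplings (the owner's
`roundingRoomF_toy`). [folklore] -/
theorem roundingRoomF_toy₃ (K : ℕ) :
    RoundingRoomF C₂ O₁ L K ((ℛ₃ L).R K) (g K) (sB₃ L g K) (sR₃ L g K) φB₁ φR₁ :=
  roundingRoomF_toy C₂ (by norm_num [C₂]) (le_of_eq rfl) L K (fun _ => L) O₁ _ φB₁ φR₁

/-- **THE TOY (1.72)-EXPANSION OF A NUMBER `z > 0`** over M1's sanity skeleton: all operations the identity, `χ ≡ 1`,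
`V ≡ 0`, completed action `A′ ≡ log (z∕6)` — six elementary terms of weight `z∕6` each (two for the all-small summand,
four for the large one), so the level's terms SUM TO `z` (`sum_term_toyR`).  [folklore] -/
def toyR (z : ℝ) : Repr172R (GoodClass.top Unit) toyI where
  χ _ _ := 1
  A' _ := Real.log (z / 6)
  TZh _ _ := RelLinPosOp.idR _
  TYl _ _ := RelLinPosOp.idR _
  TC _ _ := RelLinPosOp.idR _
  Vs _ _ _ _ _ := 0
  χ_good _ := trivial
  expA_good := trivial
  E_good _ _ _ _ := trivial
  TZh_allSmall _ := rfl
  TYl_allSmall _ := rfl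

variable {Z}

/-- every elementary term of `toyR z` weighs `z∕6` [folklore] -/
theorem eterm_toyR {z : ℝ} (hz : 0 < z) (a : toyI.Adm) (ι : toyI.HZ × toyI.HL × toyI.HC) (x : Unit) :
    (toyR z).eterm a ι x = z / 6 := by
  show (1 : ℝ) * (RelLinPosOp.idR (GoodClass.top Unit)).T
      (fun _ => Real.exp (Real.log (z / 6)) * (RelLinPosOp.idR (GoodClass.top Unit)).T
        ((RelLinPosOp.idR (GoodClass.top Unit)).T (fun _ => Real.exp 0)) x) x = z / 6
  simp [RelLinPosOp.idR, Real.exp_log (by positivity : 0 < z / 6)]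

/-- the level's full index sets of the toy skeleton have `2` (all-small summand) and `4` (large summand) choices [folklore] -/
theorem card_LIdx_toyI : (toyI.LIdx false).card = 2 ∧ (toyI.LIdx true).card = 4 := by
  constructor <;> decide

/-- **«(1.72) HOLDS» FOR `toyR z` WITH DENSITY `z`**: the terms sum to `z`. [folklore] -/
theorem sum_term_toyR {z : ℝ} (hz : 0 < z) (V : Unit) : ∑ a : toyI.Adm, (toyR z).term a V = z := by
  simp only [Repr172R.term_eq_sum_eterm, eterm_toyR hz, Finset.sum_const, Fintype.sum_bool, card_LIdx_toyI.1,
    card_LIdx_toyI.2, nsmul_eq_mul]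
  norm_num
  ring

/-- **THE WEIGHT OF EVERY TERM OF RUN `K` IS `Z K t ∕ 6`** (Dirac reference mass). [folklore] -/
theorem weight_toyR {K : ℕ} {t : ℝ} (hz : 0 < Z K t) (a : (Isk K).Adm) (ι : (Isk K).HZ × (Isk K).HL × (Isk K).HC) :
    Repr172R.weight μ₀ (fun K t => toyR (Z K t)) t ⟨K, a, ι⟩ = Z K t / 6 := by
  show ∫ x, (toyR (Z K t)).eterm a ι x ∂(Measure.dirac ()) = _
  rw [MeasureTheory.integral_dirac, eterm_toyR hz]

/-- the toy weights are nonnegative (`χ ≡ 1 ≥ 0`) [folklore] -/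
theorem weight_toyR_nonneg (t : ℝ) (τ : HIndex.Idx Isk) : 0 ≤ Repr172R.weight μ₀ (fun K t => toyR (Z K t)) t τ :=
  Repr172R.weight_nonneg μ₀ (fun K t => toyR (Z K t)) t (fun _ _ _ => zero_le_one) τ

variable (Z) in
/-- **`HistRead` HOLDS** for `Φ₃` and the toy expansions on the toy reading (empty forest; envelopes attained — the
completed-action envelope `log (Z K t ∕ 6)` by `rfl`; source radius `1`, threshold `0`). [folklore] -/
theorem histRead_toy₃ : HistRead (ℛ₃ L) (Φ₃ L g Z) (fun K t => toyR (Z K t)) 1 0 where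
  χ01 _ _ _ _ := ⟨zero_le_one, le_rfl⟩
  tz_le _ _ _ _ _ _ _ _ := le_of_eq rfl
  ty_le _ _ _ _ _ _ _ _ := le_of_eq rfl
  tc_le _ _ _ _ _ _ _ _ := le_of_eq rfl
  A'_le _ _ _ _ _ := le_rfl
  Vs_le _ _ _ _ _ _ _ _ _ := le_rfl
  forest_le K t _ _ a ι _ := by
    show (1 : ℝ) * 1 ≤ _
    rw [Finset.prod_congr rfl fun j _ => by rw [compM_runOf_eq_empty₃ L K a ι j, Finset.prod_empty],
      Finset.prod_const_one]
    norm_num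

variable (Z) in
/-- the volume calibration at `Λ ≡ 1`: doubling display with `Lu = 1` [folklore] -/
theorem hLu_toy₃ (K j : ℕ) : ∀ t i, i ≤ j → Real.log ((Φ₃ L g Z).Λ K (t + i)) ≤ 1 * Real.log ((Φ₃ L g Z).Λ K t) :=
  fun _ _ _ => by simp [Φ₃]

variable (Z) in
/-- floor display (`log 1 = 0 ≤ floorK`) [folklore] -/
theorem huΦ_toy₃ (K : ℕ) : ∀ t, t ≤ K → Real.log ((Φ₃ L g Z).Λ K t) * (6 * (561 ^ 1 * (20 : ℕ) * (1 : ℝ) + 1122 ^ 1 * 1)) ≤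
    floorK C₂ K ((ℛ₃ L).R K) t := fun t _ => by
  have h0 : 0 ≤ floorK C₂ K ((ℛ₃ L).R K) t := floorK_nonneg (C := C₂) (K := K) (R := (ℛ₃ L).R K) (by norm_num [C₂]) t
  simpa [Φ₃] using h0

variable (Z) in
/-- `E₂` display (`0 ≤ 1 · L`) [folklore] -/
theorem huE₂_toy₃ (K : ℕ) : ∀ m, m ≤ K →
    Real.log ((Φ₃ L g Z).Λ K m) * (15 * 126 ^ 1) ≤ C₂.E₂ * ((ℛ₃ L).R K m : ℝ) ^ C₂.q' := fun _ _ => by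
  simp [Φ₃, C₂, ℛ₃]

variable (Z) in
/-- `E₃` display (`0 ≤ 0`) [folklore] -/
theorem huE₃_toy₃ (K : ℕ) : ∀ m, m ≤ K →
    Real.log ((Φ₃ L g Z).Λ K m) * (24 * 126 ^ 1) ≤ C₂.E₃ * ((ℛ₃ L).R K m : ℝ) ^ C₂.q' := fun _ _ => by
  simp [Φ₃, C₂]

/-- the completed-action envelope is bounded along `|t| ≤ 1` by `log (Zi∕6)` when the generating function is (`hBA`) [folklore] -/
theorem BA_le_of_le {Zi : ℝ} (hpos : ∀ K t, |t| ≤ 1 → 0 < Z K t) (hle : ∀ K t, |t| ≤ 1 → Z K t ≤ Zi) (K : ℕ) {t : ℝ}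
    (ht : |t| ≤ 1) : (Φ₃ L g Z).BA K t ≤ Real.log (Zi / 6) :=
  Real.log_le_log (by have := hpos K t ht; positivity) (by have := hle K t ht; linarith)

end Letters

end

end Summit.QuantumFields.BalabanUV.T4Continuum.HistoryRealiseCellsRunAssemblyWTVSSanity
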